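import Summits.QuantumFields.QCD.Theses.SpectralDefectExtinction
import Literature.MathematicalPhysics.QuantumFieldTheory.SpectralDefectDensity
import Literature.MathematicalPhysics.QuantumFieldTheory.WilsonFlow

/-!
# Sketch (crux-ideate, ideator 3, round 1) — crux `WindowExtinction` (stmt-QuantumFields-8964)

First lemmas of the two idea cards `depth-participation-floor` and `flowed-feshbach-dressing`,
stated over tree declarations only (`wilsonDirac`, `fundamentalRep`, `GaugeConfig`, `QuarkIdx`,
`Site.shift`, `wilsonFlow`). Nothing is proved here; every `def … : Prop` must elaborate.
-/

namespace Summit.QuantumFields.QCD.Cruxes.WindowExtinction.Ideator3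

open scoped BigOperators Matrix
open Literature.MathematicalPhysics.QuantumLattice Literature.MathematicalPhysics.QuantumFieldTheory
  Literature.Probability.LatticeModels

/-! ## Card `depth-participation-floor` -/

/-- **Positivity identity for real Wilson modes** (the `r = 1` Wilson term is `½ Σ ∇_U† ∇_U`): if
`D_W(U,0,1) v = t v` with `t` real then `2 t ‖v‖² = Σ_{x,μ,α} ‖v(x,·,α) − U(x,μ) v(x+μ̂,·,α)‖²_{ℂ³}`.
(Shared with the sibling line `TipNoBinding/positivity-no-leak-spread`, `stub_positivity`.) -/
def RealModePositivity : Prop :=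
  ∀ (L : ℕ) [NeZero L] (U : GaugeConfig 4 L SU3) (v : QuarkIdx L → ℂ) (t : ℝ),
    (wilsonDirac (fundamentalRep (Fin 3)) U 0 1).mulVec v = (t : ℂ) • v →
      2 * t * (∑ i, ‖v i‖ ^ 2) =
        ∑ x : TorusSite 4 L, ∑ μ : Fin 4, ∑ α : Fin 4, ∑ a : Fin 3,
          ‖v (x, a, α) - ∑ b : Fin 3, fundamentalRep (Fin 3) (U (x, μ)) a b * v (Site.shift x μ, b, α)‖ ^ 2

/-- **Depth–participation floor (ℓ⁴ / inverse-participation form).** There is an absolute constant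
`S` (the critical discrete Sobolev constant on the four-torus, uniform in `L`) such that for EVERY
gauge field `U`, every real eigenpair `D_W(U,0,1) v = t v` obeys
`Σ_x |v|(x)⁴ ≤ (S √(2t) + 1/L)⁴ · (Σ_x |v|(x)²)²`, `|v|(x)² = Σ_{a,α} |v(x,a,α)|²`:
the inverse participation ratio of a real mode at depth `t` is `≤ (S√(2t) + L⁻¹)⁴`, i.e. the mode
occupies at least `(S√(2t) + L⁻¹)⁻⁴ ≍ 1/(4 S⁴ t²)` sites. (Degenerate cases are automatic:
`v = 0` gives `0 ≤ 0`; `t < 0` has no eigenvector; `t = 0` are the covariantly constant torus modes,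
for which the bound reads IPR ≤ L⁻⁴.) Proof sketch: positivity, Kato `|‖v(x)‖ − ‖v(x+μ̂)‖| ≤
‖v(x) − U v(x+μ̂)‖` (U unitary on colour), mean-zero torus Sobolev `‖f − f̄‖₄ ≤ S ‖∇f‖₂` in `d = 4`,
and `f̄ L = ‖f‖₁/L³ ≤ ‖f‖₂/L`. -/
def DepthParticipationFloor : Prop :=
  ∃ S : ℝ, 0 < S ∧ ∀ (L : ℕ) [NeZero L] (U : GaugeConfig 4 L SU3) (v : QuarkIdx L → ℂ) (t : ℝ),
    (wilsonDirac (fundamentalRep (Fin 3)) U 0 1).mulVec v = (t : ℂ) • v →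
      (∑ x : TorusSite 4 L, (∑ c : Fin 3 × Fin 4, ‖v (x, c)‖ ^ 2) ^ 2) ≤
        (S * Real.sqrt (2 * t) + 1 / (L : ℝ)) ^ 4 * (∑ i, ‖v i‖ ^ 2) ^ 2

/-- **ℓ¹-participation form** of the same floor: `Σ_i |v_i|² ≤ (S√(2t) + 1/L)⁴ (Σ_x |v|(x))²`,
i.e. `P(v) := (Σ_x |v|(x))² / Σ |v|² ≥ (S√(2t) + L⁻¹)⁻⁴` (Hölder `‖f‖₂ ≤ ‖f‖₁^{1/3} ‖f‖₄^{2/3}`). -/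
def DepthParticipationFloorL1 : Prop :=
  ∃ S : ℝ, 0 < S ∧ ∀ (L : ℕ) [NeZero L] (U : GaugeConfig 4 L SU3) (v : QuarkIdx L → ℂ) (t : ℝ),
    (wilsonDirac (fundamentalRep (Fin 3)) U 0 1).mulVec v = (t : ℂ) • v →
      (∑ i, ‖v i‖ ^ 2) ≤
        (S * Real.sqrt (2 * t) + 1 / (L : ℝ)) ^ 4 *
          (∑ x : TorusSite 4 L, Real.sqrt (∑ c : Fin 3 × Fin 4, ‖v (x, c)‖ ^ 2)) ^ 2

/-- **Coercivity-defect version** (clause (b) of the crux): a near-null singular pair of `D_W(U,m,1)`,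
`‖(D_W(U,0,1) + m) v‖ ≤ s ‖v‖` with `m ≤ 0`, is as extended as a real mode at depth `|m| + s`:
IPR `≤ (S √(2(|m| + s)) + 1/L)⁴` (positivity gives `⟨v, W v⟩ ≤ (|m| + s)‖v‖²`). -/
def CoercivityDefectFloor : Prop :=
  ∃ S : ℝ, 0 < S ∧ ∀ (L : ℕ) [NeZero L] (U : GaugeConfig 4 L SU3) (v : QuarkIdx L → ℂ) (m s : ℝ),
    m ≤ 0 → 0 ≤ s →
    ‖(WithLp.equiv 2 (QuarkIdx L → ℂ)).symm ((wilsonDirac (fundamentalRep (Fin 3)) U m 1).mulVec v)‖ ≤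
        s * ‖(WithLp.equiv 2 (QuarkIdx L → ℂ)).symm v‖ →
      (∑ x : TorusSite 4 L, (∑ c : Fin 3 × Fin 4, ‖v (x, c)‖ ^ 2) ^ 2) ≤
        (S * Real.sqrt (2 * (|m| + s)) + 1 / (L : ℝ)) ^ 4 * (∑ i, ‖v i‖ ^ 2) ^ 2

/-! ## Card `flowed-feshbach-dressing` -/

/-- **Rank-one Feshbach (Schur-complement) criterion** for the Wilson–Dirac operator and a unit
reference vector `v₀` (in the card: the real carrier mode of the FLOWED field `wilsonFlow τ U`):
with `A = D_W(U,0,1)`, `P = |v₀⟩⟨v₀|`, `Q = 1 − P`, and `t` real off the spectrum of `QAQ|_{ran Q}`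
(⇔ `QAQ − tQ + P` invertible), `t` is an eigenvalue of `A` iff
`t = ⟨v₀, A v₀⟩ − ⟨v₀, A Q (QAQ − tQ + P)⁻¹ Q A v₀⟩`. -/
def FeshbachPinning : Prop :=
  ∀ (L : ℕ) [NeZero L] (U : GaugeConfig 4 L SU3) (v₀ : QuarkIdx L → ℂ) (t : ℝ),
    star v₀ ⬝ᵥ v₀ = 1 →
    IsUnit ((1 - Matrix.vecMulVec v₀ (star v₀)) * wilsonDirac (fundamentalRep (Fin 3)) U 0 1 *
          (1 - Matrix.vecMulVec v₀ (star v₀)) -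
        (t : ℂ) • (1 - Matrix.vecMulVec v₀ (star v₀)) + Matrix.vecMulVec v₀ (star v₀)) →
      ((∃ v : QuarkIdx L → ℂ, v ≠ 0 ∧ (wilsonDirac (fundamentalRep (Fin 3)) U 0 1).mulVec v = (t : ℂ) • v) ↔
        star v₀ ⬝ᵥ (wilsonDirac (fundamentalRep (Fin 3)) U 0 1).mulVec v₀ -
          star v₀ ⬝ᵥ
            (wilsonDirac (fundamentalRep (Fin 3)) U 0 1 * (1 - Matrix.vecMulVec v₀ (star v₀)) *
              ((1 - Matrix.vecMulVec v₀ (star v₀)) * wilsonDirac (fundamentalRep (Fin 3)) U 0 1 *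
                  (1 - Matrix.vecMulVec v₀ (star v₀)) -
                (t : ℂ) • (1 - Matrix.vecMulVec v₀ (star v₀)) + Matrix.vecMulVec v₀ (star v₀))⁻¹ *
              (1 - Matrix.vecMulVec v₀ (star v₀)) * wilsonDirac (fundamentalRep (Fin 3)) U 0 1).mulVec v₀ =
          (t : ℂ))

/-- **The noise (tadpole) functional is a fixed-weight LOCAL link average.** For any two gauge fields
`U, V` (in the card `V = wilsonFlow τ U`) and any vector `w`,
`Re ⟨w, (D_W(U,0,1) − D_W(V,0,1)) w⟩ = Σ_{x,μ,α} Re ⟨w(x,·,α), (V(x,μ) − U(x,μ)) w(x+μ̂,·,α)⟩_{ℂ³}`: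
the leading term of the Feshbach expansion of the dressed position about the flowed carrier mode
`w = v₀` is a sum of single-link terms with weights `|v₀|²` fixed by the SMOOTH field. -/
def NoiseFunctionalLocal : Prop :=
  ∀ (L : ℕ) [NeZero L] (U V : GaugeConfig 4 L SU3) (w : QuarkIdx L → ℂ),
    (star w ⬝ᵥ ((wilsonDirac (fundamentalRep (Fin 3)) U 0 1 -
        wilsonDirac (fundamentalRep (Fin 3)) V 0 1).mulVec w)).re =
      ∑ x : TorusSite 4 L, ∑ μ : Fin 4, ∑ α : Fin 4,
        (∑ a : Fin 3, ∑ b : Fin 3, star (w (x, a, α)) *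
          ((fundamentalRep (Fin 3) (V (x, μ)) - fundamentalRep (Fin 3) (U (x, μ))) a b) *
            w (Site.shift x μ, b, α)).re

/-- **Flowed carriers sit at or above the tip.** A real eigenpair of the Wilson operator of the
flowed field has `t₀ ≥ 0` with `2 t₀ = Σ ‖∇_{V_τ} v₀‖²/‖v₀‖²` (positivity for `V_τ = wilsonFlow τ U`);
this is the term that the route's "smooth carriers sit at |m_crit| + c a²/ρ², c > 0" needs signed. -/
def FlowedCarrierNonneg : Prop :=
  ∀ (L : ℕ) [NeZero L] (U : GaugeConfig 4 L SU3) (τ t₀ : ℝ) (v₀ : QuarkIdx L → ℂ), v₀ ≠ 0 →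
    (wilsonDirac (fundamentalRep (Fin 3)) (wilsonFlow τ U) 0 1).mulVec v₀ = (t₀ : ℂ) • v₀ → 0 ≤ t₀

/-! ## Card `hermitian-gap-energy-identity` -/

/-- **Anticommutator identity.** `{H_W(m), Γ₅} = D_W(m) + D_W(m)ᴴ = 2(W + m)` (γ₅-Hermiticity), hence for
every eigenpair `H_W(m) φ = e φ` of the Hermitian Wilson–Dirac operator `H_W(m) = Γ₅ D_W(U,m,1)`:
`⟨φ, (D_W(m) + D_W(m)ᴴ) φ⟩ = 2 e ⟨φ, Γ₅ φ⟩` — the Wilson energy of an `H_W`-eigenvector is `|m| + e·χ`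
(for `m < 0`), χ its chirality. -/
def HermitianEigenvectorWilsonEnergy : Prop :=
  ∀ (L : ℕ) [NeZero L] (U : GaugeConfig 4 L SU3) (m e : ℝ) (φ : QuarkIdx L → ℂ),
    (spinorLift gammaFive * wilsonDirac (fundamentalRep (Fin 3)) U m 1).mulVec φ = (e : ℂ) • φ →
      star φ ⬝ᵥ ((wilsonDirac (fundamentalRep (Fin 3)) U m 1 +
          (wilsonDirac (fundamentalRep (Fin 3)) U m 1)ᴴ).mulVec φ) =
        2 * (e : ℂ) * (star φ ⬝ᵥ ((spinorLift gammaFive :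
          Matrix (QuarkIdx L) (QuarkIdx L) ℂ).mulVec φ))

/-- **Gap–energy inequality** (`|χ| ≤ 1`): every eigenpair `H_W(m) φ = e φ` obeys
`2|e| ‖φ‖² ≥ |⟨φ,(D_W(0) + D_W(0)ᴴ)φ⟩ + 2m‖φ‖²| = 2·|WilsonEnergy(φ) − |m|‖φ‖²|`: the gap of `H_W(m)` at a
level is at least the distance of that level's Wilson energy from `|m|`. At the crux's masses
`m_f(k) = −(E_k − w₀)` (E_k = |m_crit(k)|, w₀ = a_k m_f/Z_k) a clause-(b) defect `|e| < c w₀` therefore has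
Wilson energy `< E_k − (1 − c) w₀`: it is a SUB-EDGE vector, exactly like the real modes of clause (a). -/
def HermitianGapEnergyInequality : Prop :=
  ∀ (L : ℕ) [NeZero L] (U : GaugeConfig 4 L SU3) (m e : ℝ) (φ : QuarkIdx L → ℂ),
    (spinorLift gammaFive * wilsonDirac (fundamentalRep (Fin 3)) U m 1).mulVec φ = (e : ℂ) • φ →
      |(star φ ⬝ᵥ ((wilsonDirac (fundamentalRep (Fin 3)) U 0 1 +
          (wilsonDirac (fundamentalRep (Fin 3)) U 0 1)ᴴ).mulVec φ)).re + 2 * m * (∑ i, ‖φ i‖ ^ 2)| ≤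
        2 * |e| * (∑ i, ‖φ i‖ ^ 2)

/-- **The cone condition implies both EXTINCT clauses, pointwise in `U`.** If the resolvent of
`D = D_W(U,0,1)` grows at most like that of a normal operator with spectral edge `E` along the real axis
below `E − w` — `‖(D − t) φ‖ ≥ c (E − t) ‖φ‖` for all real `t ≤ E − w` and all `φ` (i.e.
`σ_min(D − t) ≥ c(E − t)`: the `c(E−t)`-pseudospectrum avoids `t`) — then for EVERY window `w₀ ≥ w`:
no real eigenvalue of `D` lies below `E − w₀` (clause (a)) and `H_W(−(E − w₀)) = Γ₅(D − (E − w₀))` has no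
eigenvalue in `(−c w₀, c w₀)` (clause (b); `|eig H_W| = singular values of D − (E − w₀)`). Conversely
clause (b) for all `w₀ ≥ w` IS the cone condition, so over the crux's `∀ m_f > M₀` the two clauses are one
resolvent-growth statement at the dressed edge. -/
def ConeImpliesNoDefects : Prop :=
  ∀ (L : ℕ) [NeZero L] (U : GaugeConfig 4 L SU3) (E w c : ℝ), 0 < w → w ≤ E → 0 < c → c ≤ 1 →
    (∀ (t : ℝ) (φ : QuarkIdx L → ℂ), t ≤ E - w →
      c * (E - t) * ‖(WithLp.equiv 2 (QuarkIdx L → ℂ)).symm φ‖ ≤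
        ‖(WithLp.equiv 2 (QuarkIdx L → ℂ)).symm
          ((wilsonDirac (fundamentalRep (Fin 3)) U 0 1 - (t : ℂ) • (1 : Matrix _ _ ℂ)).mulVec φ)‖) →
    ∀ w₀ : ℝ, w ≤ w₀ → w₀ ≤ E →
      (wilsonDirac (fundamentalRep (Fin 3)) U 0 1).charpoly.roots.countP
          (fun z : ℂ => z.im = 0 ∧ z.re < E - w₀) = 0 ∧
        (spinorLift gammaFive * wilsonDirac (fundamentalRep (Fin 3)) U (-(E - w₀)) 1).charpoly.roots.countP
          (fun z : ℂ => |z.re| < c * w₀) = 0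

end Summit.QuantumFields.QCD.Cruxes.WindowExtinction.Ideator3
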